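import Mathlib
import Literature.Analysis.FluidPDE.CKNPressureHessianSlice
import Literature.Analysis.FunctionSpaces.SobolevDifferenceQuotients
import Summits.NavierStokesRegularity.NavierStokesRegularity.Theorems.EulerZoomLiouvillePowerGaugeEulerLiouvillePastFrameSteadyConfined
import Summits.NavierStokesRegularity.NavierStokesRegularity.Theorems.EulerZoomLiouvillePowerGaugeEulerLiouvilleRotatingFrameSteady
import HarnessLib

/-!
# ROTO-PERIODIC PAST MEMBERS — slice tools (crux `EulerZoomLiouville.PowerGaugeEulerLiouville` = stmt-NavierStokesRegularity-19832;
# line `galilean_frames` symmetry strata; width seat ns-ezl-w3 g5)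

Route №10 `EulerZoomLiouville` (NavierStokesRegularity), crux E.  A member is ROTO-PERIODIC below `T₁ ≤ 0` if
`u(τ, y) = R u(τ − P, R⁻¹(y − d)) + w` for `τ < T₁`: one period `P > 0` later the field returns CONJUGATED BY A RIGID MOTION `g(y) = Ry + d`
(`R ∈ O(3)` arbitrary) and boosted by `w` — the rotational generalisation of the frame-periodic stratum `FramePeriodic.*` (ns-ezl-w6 g2; `R = id`).
This file: the slice bookkeeping.

* `RotoPeriodic.frobeniusNormSq_conj` — `|R M R⁻¹|_F = |M|_F` (basis independence of the Frobenius norm);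
* `RotoPeriodic.ae_shift_of_ae_Iio` — an a.e. property below `T` holds a.e. at `τ − P` (`P ≥ 0`);
* `RotoPeriodic.weakGradient_ae_conj_slice` — for a.e. `τ < T₁`: `H(τ, y) = R ∘ H(τ − P, R⁻¹(y − d)) ∘ R⁻¹` a.e. (slices are weak derivatives,
  `FrameSteady.ae_hasWeakFDerivOn_slice_past`; transport by `HasWeakFDerivOn.comp_add`, `RotatingFrame.hasWeakFDerivOn_comp_isometry`,
  `HasWeakFDerivOn.clm_comp`; uniqueness);
* `RotoPeriodic.setLIntegral_ball_slice_shift` — `∫_{B(Rc + d, r)} |H(τ)|²_F = ∫_{B(c, r)} |H(τ − P)|²_F` for such `τ`;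
* `RotoPeriodic.setLIntegral_box_shift` — the same for boxes `(t₁, t₂) × B(Rc + d, r)` versus `(t₁ − P, t₂ − P) × B(c, r)` (Tonelli, time shift).

WHAT THIS IS NOT: not NS regularity, not the crux E — tools for one more symmetry stratum of the crux CLASS 19832 (MODEL lattice; E/NS strata),
`--supports` stmt-19832; 19832 OPEN. [folklore]
-/

noncomputable section

-- flat `Theorems/<Route><Decl>…` files of one crux share the namespace of the crux (tree convention: `Summit.<S>.<S>.…`)
set_option linter.dupNamespace false

open MeasureTheory Set Filter Topology Metric Function TopologicalSpace
open scoped ENNReal NNReal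

namespace Summit.NavierStokesRegularity.NavierStokesRegularity.Theorems.PowerGaugeEulerLiouville

open Literature.Analysis Literature.Analysis.FunctionSpaces Literature.Analysis.FluidPDE

namespace RotoPeriodic

variable {u : ℝ → EuclideanSpace ℝ (Fin 3) → EuclideanSpace ℝ (Fin 3)}
  {H : ℝ → EuclideanSpace ℝ (Fin 3) → EuclideanSpace ℝ (Fin 3) →L[ℝ] EuclideanSpace ℝ (Fin 3)}
  {T₁ P : ℝ} {R : EuclideanSpace ℝ (Fin 3) ≃ₗᵢ[ℝ] EuclideanSpace ℝ (Fin 3)} {d w : EuclideanSpace ℝ (Fin 3)}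

/-- **Conjugation invariance of the Frobenius norm**: `|R M R⁻¹|²_F = |M|²_F` for a linear isometry `R`. [folklore] -/
theorem frobeniusNormSq_conj (L : EuclideanSpace ℝ (Fin 3) ≃ₗᵢ[ℝ] EuclideanSpace ℝ (Fin 3))
    (M : EuclideanSpace ℝ (Fin 3) →L[ℝ] EuclideanSpace ℝ (Fin 3)) :
    frobeniusNormSq ((L : EuclideanSpace ℝ (Fin 3) →L[ℝ] EuclideanSpace ℝ (Fin 3)).comp
      (M.comp (L.symm : EuclideanSpace ℝ (Fin 3) →L[ℝ] EuclideanSpace ℝ (Fin 3)))) = frobeniusNormSq M := by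
  rw [frobeniusNormSq, frobeniusNormSq_eq_sum ((stdOrthonormalBasis ℝ (EuclideanSpace ℝ (Fin 3))).map L.symm) M]
  refine Finset.sum_congr rfl fun i _ => ?_
  simp only [ContinuousLinearMap.comp_apply, LinearIsometryEquiv.coe_coe'', LinearIsometryEquiv.norm_map,
    OrthonormalBasis.map_apply]

/-- An a.e. property below `T` holds a.e. at the shifted time `τ − P` (`P ≥ 0`; translation invariance of Lebesgue measure). [folklore] -/
theorem ae_shift_of_ae_Iio {q : ℝ → Prop} {T : ℝ} (hP : 0 ≤ P) (h : ∀ᵐ τ ∂(volume.restrict (Iio T)), q τ) :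
    ∀ᵐ τ ∂(volume.restrict (Iio T)), q (τ - P) := by
  rw [ae_restrict_iff' measurableSet_Iio] at h ⊢
  have h2 := (measurePreserving_sub_right volume P).quasiMeasurePreserving.ae h
  filter_upwards [h2] with τ hτ hτT
  exact hτ (by simp only [mem_Iio] at hτT ⊢; linarith)

/-- **CONJUGATE SLICES.**  If `u(τ, ·) = R u(τ − P, R⁻¹(· − d)) + w` for `τ < T₁ ≤ 0` (`P ≥ 0`) and `H` is a weak spatial gradient of `u` on the slab,
then for a.e. `τ < T₁`: `H(τ, y) = R ∘ H(τ − P, R⁻¹(y − d)) ∘ R⁻¹` for a.e. `y`. [folklore] -/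
theorem weakGradient_ae_conj_slice
    (hH : HasWeakSpatialGradientOn (slab (EuclideanSpace ℝ (Fin 3)) (Iio 0) isOpen_Iio) u H) (hT₁ : T₁ ≤ 0) (hP : 0 ≤ P)
    (hu : ∀ τ : ℝ, τ < T₁ → u τ = fun y => R (u (τ - P) (R.symm (y - d))) + w) :
    ∀ᵐ τ ∂(volume.restrict (Iio T₁)), H τ =ᵐ[volume] fun y =>
      (R : EuclideanSpace ℝ (Fin 3) →L[ℝ] EuclideanSpace ℝ (Fin 3)).comp
        ((H (τ - P) (R.symm (y - d))).comp (R.symm : EuclideanSpace ℝ (Fin 3) →L[ℝ] EuclideanSpace ℝ (Fin 3))) := by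
  have hgood := FrameSteady.ae_hasWeakFDerivOn_slice_past hH hT₁
  have hgoodP := ae_shift_of_ae_Iio hP hgood
  filter_upwards [hgood, hgoodP, ae_restrict_mem measurableSet_Iio] with τ hτ hτP hτT
  -- transport the weak derivative of the slice `τ − P`: translate, rotate, conjugate, boost
  have h1 : HasWeakFDerivOn (⊤ : Opens (EuclideanSpace ℝ (Fin 3))) volume (fun y => u (τ - P) (y + -R.symm d))
      (fun y => H (τ - P) (y + -R.symm d)) :=
    hτP.comp_add volume fun y _ => mem_univ _
  have h2 := RotatingFrame.hasWeakFDerivOn_comp_isometry R.symm h1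
  have h3 := h2.clm_comp (R : EuclideanSpace ℝ (Fin 3) →L[ℝ] EuclideanSpace ℝ (Fin 3))
  have hc : HasWeakFDerivOn (⊤ : Opens (EuclideanSpace ℝ (Fin 3))) volume (fun _ : EuclideanSpace ℝ (Fin 3) => -w)
      (fderiv ℝ fun _ : EuclideanSpace ℝ (Fin 3) => -w) :=
    HasWeakFDerivOn.of_contDiff_holds ⊤ volume contDiff_const
  have h4 := h3.sub hc
  have e1 : ((fun y => (R : EuclideanSpace ℝ (Fin 3) →L[ℝ] EuclideanSpace ℝ (Fin 3)) (u (τ - P) (R.symm y + -R.symm d))) -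
      fun _ : EuclideanSpace ℝ (Fin 3) => -w) = u τ := by
    rw [hu τ hτT]; funext y
    simp only [Pi.sub_apply, sub_neg_eq_add, LinearIsometryEquiv.coe_coe'', map_sub, ← sub_eq_add_neg]
  have e2 : ((fun y => (R : EuclideanSpace ℝ (Fin 3) →L[ℝ] EuclideanSpace ℝ (Fin 3)).comp
        ((H (τ - P) (R.symm y + -R.symm d)).comp (R.symm : EuclideanSpace ℝ (Fin 3) →L[ℝ] EuclideanSpace ℝ (Fin 3)))) -
      fderiv ℝ fun _ : EuclideanSpace ℝ (Fin 3) => -w) =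
      fun y => (R : EuclideanSpace ℝ (Fin 3) →L[ℝ] EuclideanSpace ℝ (Fin 3)).comp
        ((H (τ - P) (R.symm (y - d))).comp (R.symm : EuclideanSpace ℝ (Fin 3) →L[ℝ] EuclideanSpace ℝ (Fin 3))) := by
    funext y; simp [sub_eq_add_neg]
  rw [e1, e2] at h4
  have h5 := HasWeakFDerivOn.unique_holds hτ h4
  rw [Opens.coe_top, Measure.restrict_univ] at h5
  exact h5

/-- **Rotated, hopped ball masses of conjugate slices agree**: if `H(τ, y) = R ∘ H(τ − P, R⁻¹(y − d)) ∘ R⁻¹` a.e., then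
`∫_{B(Rc + d, r)} |H(τ)|²_F = ∫_{B(c, r)} |H(τ − P)|²_F`. [folklore] -/
theorem setLIntegral_ball_slice_shift {τ : ℝ}
    (hτ : H τ =ᵐ[volume] fun y => (R : EuclideanSpace ℝ (Fin 3) →L[ℝ] EuclideanSpace ℝ (Fin 3)).comp
      ((H (τ - P) (R.symm (y - d))).comp (R.symm : EuclideanSpace ℝ (Fin 3) →L[ℝ] EuclideanSpace ℝ (Fin 3))))
    (c : EuclideanSpace ℝ (Fin 3)) (r : ℝ) :
    ∫⁻ y in ball (R c + d) r, ENNReal.ofReal (frobeniusNormSq (H τ y)) =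
      ∫⁻ z in ball c r, ENNReal.ofReal (frobeniusNormSq (H (τ - P) z)) := by
  -- the rigid motion `g z = R z + d`
  have hmp : MeasurePreserving (fun z : EuclideanSpace ℝ (Fin 3) => R z + d) volume volume :=
    (measurePreserving_add_right volume d).comp R.measurePreserving
  have hme : MeasurableEmbedding (fun z : EuclideanSpace ℝ (Fin 3) => R z + d) :=
    (R.toMeasurableEquiv.trans (MeasurableEquiv.addRight d)).measurableEmbedding
  have h := hmp.setLIntegral_comp_preimage_emb hme (fun y => ENNReal.ofReal (frobeniusNormSq (H τ y))) (ball (R c + d) r)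
  have hpre : (fun z : EuclideanSpace ℝ (Fin 3) => R z + d) ⁻¹' ball (R c + d) r = ball c r := by
    ext z
    simp only [mem_preimage, mem_ball, dist_eq_norm, add_sub_add_right_eq_sub, ← map_sub, LinearIsometryEquiv.norm_map]
  rw [hpre] at h
  rw [← h]
  refine setLIntegral_congr_fun_ae measurableSet_ball ?_
  filter_upwards [hmp.quasiMeasurePreserving.ae_eq hτ] with z hz _
  simp only [Function.comp_apply] at hz
  rw [hz, add_sub_cancel_right, LinearIsometryEquiv.symm_apply_apply, frobeniusNormSq_conj]

/-- **Rotated, hopped BOX masses agree**: if the slices are conjugate for a.e. `τ < T₁ ≤ 0`, then for `t₂ ≤ T₁`, `P ≥ 0`,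
`∫_{(t₁, t₂) × B(Rc + d, r)} |H|²_F = ∫_{(t₁ − P, t₂ − P) × B(c, r)} |H|²_F` (Tonelli and the time shift). [folklore] -/
theorem setLIntegral_box_shift
    (hHm : AEStronglyMeasurable (uncurry H) (volume.restrict (Iio (0 : ℝ) ×ˢ (univ : Set (EuclideanSpace ℝ (Fin 3))))))
    (hT₁ : T₁ ≤ 0) (hP : 0 ≤ P)
    (hconj : ∀ᵐ τ ∂(volume.restrict (Iio T₁)), H τ =ᵐ[volume] fun y =>
      (R : EuclideanSpace ℝ (Fin 3) →L[ℝ] EuclideanSpace ℝ (Fin 3)).comp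
        ((H (τ - P) (R.symm (y - d))).comp (R.symm : EuclideanSpace ℝ (Fin 3) →L[ℝ] EuclideanSpace ℝ (Fin 3))))
    {t₁ t₂ : ℝ} (ht₂ : t₂ ≤ T₁) (c : EuclideanSpace ℝ (Fin 3)) (r : ℝ) :
    ∫⁻ z in Ioo t₁ t₂ ×ˢ ball (R c + d) r, ENNReal.ofReal (frobeniusNormSq (H z.1 z.2)) =
      ∫⁻ z in Ioo (t₁ - P) (t₂ - P) ×ˢ ball c r, ENNReal.ofReal (frobeniusNormSq (H z.1 z.2)) := by
  set f : ℝ × EuclideanSpace ℝ (Fin 3) → ℝ≥0∞ := fun z => ENNReal.ofReal (frobeniusNormSq (H z.1 z.2)) with hf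
  -- measurability on boxes below `0`
  have hfm : ∀ (s₁ s₂ : ℝ) (S : Set (EuclideanSpace ℝ (Fin 3))), s₂ ≤ 0 →
      AEMeasurable f ((volume.restrict (Ioo s₁ s₂)).prod (volume.restrict S)) := by
    intro s₁ s₂ S hs₂
    have h1 : AEStronglyMeasurable (uncurry H) (volume.restrict (Ioo s₁ s₂ ×ˢ S)) :=
      hHm.mono_set (Set.prod_mono (fun τ hτ => lt_of_lt_of_le hτ.2 hs₂) (subset_univ _))
    rw [Measure.volume_eq_prod, ← Measure.prod_restrict] at h1
    exact ((ENNReal.continuous_ofReal.comp LerayHopfProofs.continuous_frobeniusNormSq).comp_aestronglyMeasurable h1).aemeasurable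
  have ht₂0 : t₂ ≤ 0 := ht₂.trans hT₁
  have ht₂P : t₂ - P ≤ 0 := by linarith
  -- Tonelli on both boxes
  rw [Measure.volume_eq_prod, ← Measure.prod_restrict, lintegral_prod _ (hfm t₁ t₂ _ ht₂0),
    ← Measure.prod_restrict, lintegral_prod _ (hfm (t₁ - P) (t₂ - P) _ ht₂P)]
  -- slice by slice on `(t₁, t₂)`
  have hslice : ∀ᵐ τ ∂(volume.restrict (Ioo t₁ t₂)),
      ∫⁻ y in ball (R c + d) r, f (τ, y) = ∫⁻ y in ball c r, f (τ - P, y) := by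
    filter_upwards [ae_restrict_of_ae_restrict_of_subset (fun τ hτ => lt_of_lt_of_le hτ.2 ht₂ : Ioo t₁ t₂ ⊆ Iio T₁) hconj]
      with τ hτ
    exact setLIntegral_ball_slice_shift hτ c r
  rw [lintegral_congr_ae hslice]
  -- the time shift `τ ↦ τ − P`
  have h := (measurePreserving_sub_right volume P).setLIntegral_comp_preimage_emb (MeasurableEquiv.subRight P).measurableEmbedding
    (fun σ => ∫⁻ y in ball c r, f (σ, y)) (Ioo (t₁ - P) (t₂ - P))
  have hpre : (fun τ : ℝ => τ - P) ⁻¹' Ioo (t₁ - P) (t₂ - P) = Ioo t₁ t₂ := by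
    ext τ; simp only [mem_preimage, mem_Ioo]; constructor <;> rintro ⟨h1, h2⟩ <;> constructor <;> linarith
  rw [hpre] at h
  exact h

end RotoPeriodic

end Summit.NavierStokesRegularity.NavierStokesRegularity.Theorems.PowerGaugeEulerLiouville

end
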